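import Literature.IUT.HodgeTheaters.Cor53iArithHBOfBrigidKummer
import HarnessLib

/-!
# Layer-5 certificate v0.23 — BLOCK G over BUILT Literature modules only: [IUTchI] Cor 5.3 (i) at `ℱ^⊛(†𝒟^⊚)` with the
# 𝔹-RATIO binder `hB⊛` DROPPED — «bijective» modulo Neukirch–Uchida ALONE; injectivity / `hker⊛` UNCONDITIONAL
# (abc-iut-L5-lead gen 10 RULINGS #167 (2) / #168 (3) / #169 (2) «V23 = V22 with hB⊛ dropped after K2-c»; CERT-L5 R73 holder
# abc-iut-L5-t16 gen 13; plan/L5/LAYER5-CERT-SPEC.md §7)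

PROOF-ONLY (no `def`, no `instance`, no `axiom`, no `sorry`, no `notation`); NO `Conditional` import (architecture-neutral: serves a
chained top `Layer5OfSV23` = `StatementOf v22 ∧ …` or any later flat top).  Every theorem is a landed Literature theorem VERBATIM,
proof BY NAME — one-call only — from abc-iut-L5-t11's knit (c) `Cor53iArithHBOfBrigidKummer` (BRATIO split of record:
(a) «C411-UNITS@ARITH» ★ p534324 + ★ p536328 [FrdI] Cor 4.10 / Thm 5.2 (ii) units transport · (b) «BRIGID-KUMMER» ★ p532034 +
★ p532790 + ★ p534873 classical Kummer rigidity · K2-a pre-knit ★ p537662):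
* (C-53i⊛′) `layer5_disch_cor53i_v23_arith` := `Cor53.arith_descendBijective_of_neukirchUchida`: [IUTchI] Cor 5.3 (i) AS PRINTED
  («bijective») at the genuine arithmetic model `ℱ^⊛(†𝒟^⊚) → ℬ(G_F)⁰`, DISPLAYED binder exactly {`hNU : NeukirchUchida F`} (FACT,
  BY NAME) — v0.22's (C-53i⊛) with `hB⊛` DISCHARGED;
* (C-53i⊛-ker) `layer5_disch_cor53i_v23_arith_rigidOverBase` := `Cor53.arith_rigidOverBase`: `hker⊛` — every self-equivalence of
  `ℱ^⊛(†𝒟^⊚)` over the identity of `†𝒟^⊛` is `≅ 𝟭` — NO hypothesis;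
* (C-53i⊛-inj) `layer5_disch_cor53i_v23_arith_descend_injective` := `Cor53.arith_descend_injective`: `Aut(ℱ^⊛(†𝒟^⊚)) → Aut(†𝒟^⊛)`
  injective — NO hypothesis.
The `⊚`-slot conjunct (C-53i⊚) of v0.22 is UNCHANGED (its `hB⊚` stays DISPLAYED: satisfiable only at geometric `toBase0`, note of
record RULINGS #173 (3); repaired binder = row «HBCIRC-PUSH», not keyed).  CENSUS delta for §7 (the lead's booking): display −1
binder on (C-53i⊛) (hB⊛ ⟸ PROVED), +2 unconditional conjuncts; CONE/FACT unchanged.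
S. Mochizuki, *Inter-universal Teichmüller theory I* [cite: Mochizuki2012] (D-0012 claim key; series status DISPUTED): Cor 5.3 (i)
p. 144; Ex 5.1 (v) p. 128.  HONEST FRAMING: a CERT conjunct DISPLAYS its binders, it does not discharge them; `NeukirchUchida F` is a
published theorem carried BY NAME as a `Prop`, not proved here; nothing here asserts that abc is proved or refuted or takes a side on
[IUTchIII] Cor. 3.12; typed ≠ inhabited ≠ discharged; indexed ≠ endorsed.
-/

namespace Summit.ABC.IUTFork.Conditional

open CategoryTheory Opposite Literature.IUT.HodgeTheaters
open Literature.AnabelianGeometry.SemiGraphs Literature.AlgebraicGeometry.Frobenioids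
open Literature.NumberTheory.GaloisRepresentations

noncomputable section BlocksGV23

/-- **(C-53i⊛′) [IUTchI] Cor 5.3 (i) AS PRINTED («bijective») at the genuine arithmetic model `ℱ^⊛(†𝒟^⊚) → ℬ(G_F)⁰`, `hB⊛` DROPPED**
:= abc-iut-L5-t11's ★ `Cor53.arith_descendBijective_of_neukirchUchida` (knit (c) of the BRATIO split: (a) [FrdI] Cor 4.10 / Thm 5.2 (ii)
units transport ★ p534324/★ p536328, (b) classical Kummer rigidity ★ p532034/★ p532790/★ p534873, K2-a ★ p537662).  DISPLAYED binder
exactly: `hNU : NeukirchUchida F` (FACT, BY NAME; the surjectivity half through ★ p525660).  Injectivity alone is `(this …).1`.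
[cite: Mochizuki2012, IUTchI Cor 5.3 (i) p.144] [claim: Mochizuki2012, status: disputed] -/
theorem layer5_disch_cor53i_v23_arith (F : Type) [Field F] [NumberField F] (hNU : NeukirchUchida F) :
    CatIsomorphism.DescendBijective (GlobalDivisorData.arith F).modelBase (GlobalDivisorData.arith F).modelBase
      (GlobalDivisorData.hasUnder_modelBase_arith F F) (GlobalDivisorData.underUnique_modelBase_arith F F) :=
  Cor53.arith_descendBijective_of_neukirchUchida F hNU

/-- **(C-53i⊛-ker) `hker⊛` UNCONDITIONAL**: every self-equivalence of `ℱ^⊛(†𝒟^⊚)` lying over the identity of `†𝒟^⊛ = ℬ(G_F)⁰` is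
isomorphic to the identity self-equivalence := ★ `Cor53.arith_rigidOverBase` (NO hypothesis).
[cite: Mochizuki2012, IUTchI Cor 5.3 (i) p.144] [claim: Mochizuki2012, status: disputed] -/
theorem layer5_disch_cor53i_v23_arith_rigidOverBase (F : Type) [Field F] [NumberField F] :
    CatIsomorphism.RigidOverBase (GlobalDivisorData.arith F).modelBase :=
  Cor53.arith_rigidOverBase F

/-- **(C-53i⊛-inj) injectivity of `Aut(ℱ^⊛(†𝒟^⊚)) → Aut(†𝒟^⊛)` UNCONDITIONAL** := ★ `Cor53.arith_descend_injective` (NO hypothesis).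
[cite: Mochizuki2012, IUTchI Cor 5.3 (i) p.144] [claim: Mochizuki2012, status: disputed] -/
theorem layer5_disch_cor53i_v23_arith_descend_injective (F : Type) [Field F] [NumberField F] :
    Function.Injective (CatIsomorphism.descend (GlobalDivisorData.hasUnder_modelBase_arith F F)
      (GlobalDivisorData.underUnique_modelBase_arith F F)) :=
  Cor53.arith_descend_injective F

end BlocksGV23

end Summit.ABC.IUTFork.Conditional

/-! ### Build-lane export guard (ops-buildfix bf1-g30, 2026-08-28; G11b-3 recipe v2 as in `GelbartRogawski1991/UnitaryDualPairSeesawCharacter`):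
the theorems of this file carry very large dependent telescopes; at `.olean` export Lean 4.32's library-suggestion indexers fold over
every local theorem statement and do not finish within the build lane's one-hour clock (measured on a farm node: `lean -o` > 1 500 s, plain
elaboration ≈ 20 s). ONE file-final `local` `[implicit_reducible]` keeps them out of that premise index (inert for Meta and the kernel on
theorems; no definition is tagged; statements and proofs unchanged). -/
set_option allowUnsafeReducibility true in
attribute [local implicit_reducible]
  _root_.Summit.ABC.IUTFork.Conditional.layer5_disch_cor53i_v23_arith
  _root_.Summit.ABC.IUTFork.Conditional.layer5_disch_cor53i_v23_arith_rigidOverBase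
  _root_.Summit.ABC.IUTFork.Conditional.layer5_disch_cor53i_v23_arith_descend_injective
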